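import Mathlib.Analysis.Matrix.Spectrum
import Literature.MathematicalPhysics.QuantumFieldTheory.QCDOS
import Literature.MathematicalPhysics.QuantumFieldTheory.QCD
import Literature.MathematicalPhysics.QuantumFieldTheory.LatticeGaugeProofs
import HarnessLib

/-!
# Spectral defects of the Wilson–Dirac operator: real-eigenvalue counts, their densities along a
lattice QCD scheme, and box-localised real modes

Definition request `defn-spectralDefectDensity` (topic `Literature/MathematicalPhysics/QuantumFieldTheory`,
next to `QCDOS`; idea card `af-entropy-vs-wilson-spectral-defects` D1; wanted by the routes
`DiagonalSpine` (`FullLatticeGap`), `HeavyThresholdBridge`, `SpectralDefectExtinction`, `SeaNonGibbs`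
of `Summit.QuantumFields.QCD`).

## Informal content

The Wilson–Dirac operator `D_W(U, m₀, r)` of the tree (`wilsonDirac`) is `γ₅`-Hermitian, so its
determinant is real and its eigenvalues are real or come in complex-conjugate pairs; hence
"negative values of the fermion determinant appear if there is an odd number `n_neg` of negative
real eigenvalues of `D`" (Mohler–Schaefer 2020, §2), the reweighting factor from the modulus
("phase-quenched") ensemble `⟨·⟩₊` to the signed theory is `W = det D/|det D| = (-1)^{n_neg}`,
`⟨A⟩ = ⟨A W⟩₊/⟨W⟩₊` (ibid. §2.1), and since "`D(m) = D(0) + m`, for increasing quark mass the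
negative real eigenvalues will first decrease in magnitude before going through zero" (ibid. §4).
In the spectral-flow language of Edwards–Heller–Narayanan (`H_L(m) = γ₅ W(-m)`), a level of `H_L`
crossing zero at mass parameter `m` is a real eigenvalue `m` of the massless Wilson operator; they
measure "the density of levels crossing zero in an infinitesimal range `dm`", the "size of the
eigenvector associated with the level crossing zero mode" (small modes of "about 1 or 2 lattice
spacings"), and find that "`ρ(0;m)` goes to zero away from `m = 0`" towards the continuum limit
(EHN 1999, §4 and §6); Berruto–Narayanan–Neuberger exhibit exact real modes carried by finite
link clusters, "a finite density of fermionic zero modes … exponentially suppressed in the gauge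
coupling constant", and ask "how this suppression relates to the standard asymptotic freedom
formula for a density of dimension four" (BNN 2000, §2 and §7). Mohler–Schaefer measure the
phase-quenched expectation `⟨n_neg⟩ ≈ 2%, 0.3%, 0.05%` at `β = 3.4–3.46, 3.55, 3.7`: "negative real
eigenvalues quickly become unlikely as the continuum limit is approached" (§4.2).

A **spectral defect** of a gauge field `U` at bare mass `m₀` and threshold `t` is a REAL
eigenvalue `λ ≤ t` of `D_W(U, m₀, 1)` (algebraic multiplicity). On the bare trajectory
`m_f(k) = m_crit(k) + a_k m_f/Z_m(k)` of a `QCDRegularisation` the CLEAN situation is "all real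
eigenvalues of `D_W(U, m_f(k), 1)` are `≥ a_k m_f/Z_m(k)`" (the real modes of the massless operator
start at the critical edge `-m_crit(k)`); the canonical defect threshold is half that clean gap,
`t = a_k m_f/(2 Z_m(k))`. The **spectral-defect density** is the expected number of defects per
lattice site, summed over flavours, under the quenched Wilson measure (`qcdGaugeMeasure`) or under
the phase-quenched `|det|`-reweighted measure (`qcdLatticeMeasure`, Mohler–Schaefer's `⟨·⟩₊`);
"extinction" is: density per PHYSICAL four-volume (`/a_k⁴`) tends to `0` along the scheme.

## Contents

* matrix level (any `Matrix n n ℂ`): `specCountIn A S` (eigenvalues in a set, algebraic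
  multiplicity = roots of `Matrix.charpoly`), `realSpecCount A t` (real eigenvalues `≤ t`), with
  `realSpecCount_le_card`, `realSpecCount_mono`, `realSpecCount_add_scalar` (mass shift),
  `realSpecCount_eq_card_filter_of_isHermitian` (for Hermitian `A`: the number of `eigenvalues ≤ t`);
* Wilson level (`SU(3)`, fundamental, `r = 1`, torus of side `L`): `realEigenvalueCount U m₀ t`,
  `wilsonDirac_mass_eq_add_scalar` (`D_W(m₀) = D_W(0) + m₀`), `realEigenvalueCount_eq_massless`,
  `realEigenvalueCount_le`, `realEigenvalueCount_mono`;
* densities: `realModeDensity μ mq t` (any measure, any torus — the form needed "on every torus at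
  least the scheme's"), `QCDScheme.quenchedDefectDensity`, `QCDScheme.reweightedDefectDensity`
  (explicit thresholds), `QCDRegularisation.defectThreshold` (half the clean gap),
  `spectralDefectDensity reg m k` (reweighted, canonical threshold — THE requested notion),
  `quenchedSpectralDefectDensity reg m k`, `QCDRegularisation.physicalDensity` /
  `physicalSpectralDefectDensity` (per physical volume) and the predicates
  `QCDRegularisation.HasDefectExtinction reg ρ` (generic density sequence, with `of_le`) and
  `QCDRegularisation.HasSpectralDefectExtinction reg m` (its canonical instance);
* localisation: `torusBox L c R` (image of `c + {-R,…,R}⁴` on the torus), `boxMass v B` (ℓ²-mass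
  of a quark-index vector on a set of sites), `IsBoxLocalised v B ε` (mass fraction `≥ 1 - ε` in `B`),
  `HasLocalisedRealMode U m₀ ev c R ε` (a real eigenvalue `ev` of `D_W(U, m₀, 1)` with an eigenvector
  `(1-ε)`-localised in the box of radius `R` about `c`).

## Design choices, junk values, what is NOT here

* Eigenvalues are counted WITH ALGEBRAIC MULTIPLICITY as roots of the characteristic polynomial
  (`Matrix.charpoly A).roots`, a `Multiset`), the same inline form as the route file
  `SpectralDefectExtinction` (`Multiset.countP … (wilsonDirac … U 0 1).charpoly.roots`); thresholds
  are CLOSED (`≤ t`) as requested. Mohler–Schaefer's `n_neg` is the open count `< 0`; it agrees with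
  `realEigenvalueCount U m 0` off the determinant-zero set.
* Measurability of `U ↦ realEigenvalueCount U m₀ t` (a semialgebraic, upper-semicontinuous function
  of the links) is NOT proved here; the densities are Bochner integrals, junk `0` for a
  non-integrable integrand (the count is bounded by `12 L⁴`, so integrability = measurability), as in
  `QCD.lean`. `qcdLatticeMeasure` is junk unless its weight has finite non-zero mass (`QCD.lean`).
* The Hermitian window count of coercivity defects (eigenvalues of `Γ₅ D_W(m)` in `(-w, w)`) is the
  one-liner `specCountIn (spinorLift gammaFive * wilsonDirac _ U m 1) {z | |z.re| < w}` and is not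
  given a separate name; no statement about WHERE real modes sit (EHN's `m₁(β)`, BNN's cluster
  thresholds) is vendored — those are empirical.
-/

noncomputable section

open MeasureTheory Filter Polynomial
open scoped _root_.Topology
open Literature.MathematicalPhysics.QuantumLattice Literature.Probability.LatticeModels

namespace Literature.MathematicalPhysics.QuantumFieldTheory

/-! ### Matrix level: counting eigenvalues with algebraic multiplicity -/

section MatrixLevel

variable {n : Type*} [Fintype n] [DecidableEq n]

/-- The number of eigenvalues of the complex square matrix `A` lying in the set `S`, counted with
ALGEBRAIC multiplicity: the number of roots of the characteristic polynomial in `S`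
(`Matrix.charpoly`, `Polynomial.roots` as a multiset; over `ℂ` it has `card n` elements). [folklore] -/
def specCountIn (A : Matrix n n ℂ) (S : Set ℂ) [DecidablePred (· ∈ S)] : ℕ :=
  A.charpoly.roots.countP (· ∈ S)

/-- The number of REAL eigenvalues `λ ≤ t` of the complex square matrix `A`, counted with algebraic
multiplicity (the name `realSpecCount` is the idea card's): roots `z` of `A.charpoly` with
`Im z = 0` and `Re z ≤ t`. For a `γ₅`-Hermitian lattice Dirac operator the non-real eigenvalues come
in conjugate pairs, so the sign of the (real) determinant of `A` is `(-1)^{#real eigenvalues < 0}`.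
[cite: MohlerSchaefer2020, §2 (n_neg)] -/
def realSpecCount (A : Matrix n n ℂ) (t : ℝ) : ℕ :=
  A.charpoly.roots.countP fun z => z.im = 0 ∧ z.re ≤ t

/-- `realSpecCount` is `specCountIn` for the closed real half-line `{z | Im z = 0, Re z ≤ t}`. [folklore] -/
theorem realSpecCount_eq_specCountIn (A : Matrix n n ℂ) (t : ℝ) :
    realSpecCount A t = specCountIn A {z : ℂ | z.im = 0 ∧ z.re ≤ t} := rfl

/-- The definition does not depend on the decidability instance used to count (so it matches any
inline `Multiset.countP (fun z : ℂ => z.im = 0 ∧ z.re ≤ t) …`, e.g. under `open Classical`). [folklore] -/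
theorem countP_roots_eq_realSpecCount (A : Matrix n n ℂ) (t : ℝ)
    [DecidablePred fun z : ℂ => z.im = 0 ∧ z.re ≤ t] :
    A.charpoly.roots.countP (fun z : ℂ => z.im = 0 ∧ z.re ≤ t) = realSpecCount A t := by
  unfold realSpecCount
  congr 1

/-- There are at most `card n` real eigenvalues below any threshold (with multiplicity). [folklore] -/
theorem realSpecCount_le_card (A : Matrix n n ℂ) (t : ℝ) : realSpecCount A t ≤ Fintype.card n := by
  unfold realSpecCount
  calc A.charpoly.roots.countP (fun z : ℂ => z.im = 0 ∧ z.re ≤ t)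
      ≤ Multiset.card A.charpoly.roots := Multiset.countP_le_card _ _
    _ ≤ A.charpoly.natDegree := Polynomial.card_roots' _
    _ = Fintype.card n := Matrix.charpoly_natDegree_eq_dim A

/-- The real-eigenvalue count is monotone in the threshold. [folklore] -/
theorem realSpecCount_mono (A : Matrix n n ℂ) : Monotone (realSpecCount A) := by
  intro s t hst
  unfold realSpecCount
  rw [Multiset.countP_eq_card_filter, Multiset.countP_eq_card_filter]
  exact Multiset.card_le_card
    (Multiset.monotone_filter_right _ fun z hz => ⟨hz.1, hz.2.trans hst⟩)

/-- **Mass shift.** Adding a real scalar `s` shifts every eigenvalue by `s`: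
`#{real eigenvalues of A + s·1 that are ≤ t} = #{real eigenvalues of A that are ≤ t - s}`
(`Matrix.charpoly_sub_scalar`: the characteristic polynomial is composed with `X + C s`).
This is "`D(m) = D(0) + m`": the real modes of the massive operator are the real modes of the
massless one, translated. [cite: MohlerSchaefer2020, §4] -/
theorem realSpecCount_add_scalar (A : Matrix n n ℂ) (s t : ℝ) :
    realSpecCount (A + Matrix.scalar n (s : ℂ)) t = realSpecCount A (t - s) := by
  have hA : A = A + Matrix.scalar n (s : ℂ) - Matrix.scalar n (s : ℂ) := by simp
  have hroots : A.charpoly.roots =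
      (A + Matrix.scalar n (s : ℂ)).charpoly.roots.map fun z => z - (s : ℂ) := by
    conv_lhs => rw [hA, Matrix.charpoly_sub_scalar]
    rw [show (X + C (s : ℂ) : ℂ[X]) = C 1 * X + C (s : ℂ) by simp,
      Polynomial.roots_comp_C_mul_X_add_C _ _ _ isUnit_one]
    simp
  unfold realSpecCount
  rw [hroots, Multiset.countP_map, ← Multiset.countP_eq_card_filter]
  refine Multiset.countP_congr rfl fun z _ => propext ?_
  simp only [Complex.sub_im, Complex.ofReal_im, sub_zero, Complex.sub_re, Complex.ofReal_re]
  constructor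
  · rintro ⟨h1, h2⟩; exact ⟨h1, by linarith⟩
  · rintro ⟨h1, h2⟩; exact ⟨h1, by linarith⟩

/-- **For a Hermitian matrix the count is the number of eigenvalues `≤ t`** in Mathlib's
enumeration `hA.eigenvalues : n → ℝ` (`Matrix.IsHermitian.roots_charpoly_eq_eigenvalues`): the
algebraic count of this file agrees with the spectral-theorem count used for the Hermitian
Wilson–Dirac operator `Γ₅ D_W` (cf. `negModes` in the barrier `WilsonDeterminantSign`). [folklore] -/
theorem realSpecCount_eq_card_filter_of_isHermitian {A : Matrix n n ℂ} (hA : A.IsHermitian)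
    (t : ℝ) : realSpecCount A t = (Finset.univ.filter fun i => hA.eigenvalues i ≤ t).card := by
  unfold realSpecCount
  rw [hA.roots_charpoly_eq_eigenvalues, Multiset.countP_map, Finset.card_def, Finset.filter_val]
  congr 1
  refine Multiset.filter_congr fun i _ => ?_
  simp

end MatrixLevel

/-! ### Wilson level: real modes of `D_W(U, m₀, 1)` for `SU(3)`, fundamental quarks, `r = 1` -/

section Wilson

variable {L : ℕ} [NeZero L]

/-- **`realEigenvalueCount U m₀ t`: the number (with algebraic multiplicity) of REAL eigenvalues
`λ ≤ t` of the Wilson–Dirac operator `D_W(U, m₀, 1)`** (tree `wilsonDirac`, fundamental `SU(3)`,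
Wilson parameter `r = 1`) on the four-torus of side `L`, in the gauge background `U` at bare mass
`m₀`. Equivalently (`realEigenvalueCount_eq_massless`) the number of real eigenvalues `≤ t - m₀` of
the massless operator, i.e. of the values `s ≥ m₀ - t` at which `det D_W(U, s, 1) = det(Γ₅ D_W(U, s, 1))`
vanishes (levels of the Hermitian Wilson–Dirac operator crossing zero, Edwards–Heller–Narayanan's
spectral flow with their mass parameter `m = -s`). `realEigenvalueCount U m₀ 0` is Mohler–Schaefer's
`n_neg` plus the exact zero modes. [cite: MohlerSchaefer2020, §2 and §4] [cite: EdwardsHellerNarayanan1999, §4 (levels crossing zero)] -/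
def realEigenvalueCount (U : GaugeConfig 4 L SU3) (m₀ t : ℝ) : ℕ :=
  realSpecCount (wilsonDirac (fundamentalRep (Fin 3)) U m₀ 1) t

/-- Unfolding `realEigenvalueCount` to the inline `Multiset.countP` form over the roots of the
characteristic polynomial of `wilsonDirac (fundamentalRep (Fin 3)) U m₀ 1`. [folklore] -/
theorem realEigenvalueCount_eq_countP (U : GaugeConfig 4 L SU3) (m₀ t : ℝ) :
    realEigenvalueCount U m₀ t =
      (wilsonDirac (fundamentalRep (Fin 3)) U m₀ 1).charpoly.roots.countP
        fun z => z.im = 0 ∧ z.re ≤ t := rfl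

/-- **The bare mass enters additively**: `D_W(U, m₀, 1) = D_W(U, 0, 1) + m₀·1` ("`D(m) = D(0) + m`";
the tree's `wilsonDirac` has diagonal `m + 4r`). (Also in the barrier catalogue as
`wilsonDirac_add_mass`; restated here to keep this file inside `Literature/MathematicalPhysics`.)
[cite: MohlerSchaefer2020, §4] -/
theorem wilsonDirac_mass_eq_add_scalar {N : ℕ} {G : Type*} [Group G]
    (ρ : G →* Matrix (Fin N) (Fin N) ℂ) (U : GaugeConfig 4 L G) (m₀ r : ℝ) :
    wilsonDirac ρ U m₀ r = wilsonDirac ρ U 0 r + Matrix.scalar _ (m₀ : ℂ) := by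
  ext p q
  rw [Matrix.add_apply, Matrix.scalar_apply]
  simp only [wilsonDirac, Matrix.of_apply, Matrix.diagonal_apply]
  by_cases h : p = q
  · rw [if_pos h, if_pos h, if_pos h]; push_cast; ring
  · rw [if_neg h, if_neg h, if_neg h, add_zero]

/-- **Massive count = shifted massless count**: the real eigenvalues `≤ t` of `D_W(U, m₀, 1)` are the
real eigenvalues `≤ t - m₀` of `D_W(U, 0, 1)` — the form in which the route `SpectralDefectExtinction`
counts sign defects ("real eigenvalues of `D_W(U,0,1)` below `-m_f(k)`"). [cite: MohlerSchaefer2020, §4] -/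
theorem realEigenvalueCount_eq_massless (U : GaugeConfig 4 L SU3) (m₀ t : ℝ) :
    realEigenvalueCount U m₀ t = realEigenvalueCount U 0 (t - m₀) := by
  unfold realEigenvalueCount
  rw [wilsonDirac_mass_eq_add_scalar (fundamentalRep (Fin 3)) U m₀ 1, realSpecCount_add_scalar]

/-- One Wilson flavour on the torus of side `L` has `12 L⁴` components (site × colour × spin). [folklore] -/
theorem card_quarkIdx : Fintype.card (QuarkIdx L) = 12 * L ^ 4 := by
  simp only [QuarkIdx, TorusSite, Fintype.card_prod, Fintype.card_fun, ZMod.card, Fintype.card_fin]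
  ring

/-- At most `12 L⁴` real eigenvalues (the dimension of one flavour). [folklore] -/
theorem realEigenvalueCount_le (U : GaugeConfig 4 L SU3) (m₀ t : ℝ) :
    realEigenvalueCount U m₀ t ≤ 12 * L ^ 4 := by
  rw [← card_quarkIdx (L := L)]
  exact realSpecCount_le_card _ t

/-- The count is monotone in the threshold. [folklore] -/
theorem realEigenvalueCount_mono (U : GaugeConfig 4 L SU3) (m₀ : ℝ) :
    Monotone (realEigenvalueCount U m₀) :=
  realSpecCount_mono _

/-! ### Densities: expected number of real modes per lattice site -/

variable {Nf : ℕ}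

/-- **Real-mode density under a measure `μ` on gauge fields of the torus of side `L`**: the
`μ`-integral of `∑_f realEigenvalueCount U (m_f) (t_f)` (flavour `f` read at its bare mass `m_f`
with its threshold `t_f`), divided by the number `L⁴` of lattice sites. For a probability measure
this is the expected number of real modes below threshold per site (Mohler–Schaefer's `⟨n_neg⟩`
is the un-normalised `t = 0` case under the phase-quenched measure; EHN/BNN: the number of small
real modes is proportional to the lattice volume, hence a density). Bochner integral: junk `0` if
the integrand is not integrable. [cite: MohlerSchaefer2020, §2.1 and §4.2] [cite: BerrutoNarayananNeuberger2000, §7] -/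
def realModeDensity (μ : Measure (GaugeConfig 4 L SU3)) (mq t : Fin Nf → ℝ) : ℝ :=
  (∫ U, (∑ f, (realEigenvalueCount U (mq f) (t f) : ℝ)) ∂μ) / (L : ℝ) ^ 4

/-- The real-mode density is non-negative. [folklore] -/
theorem realModeDensity_nonneg (μ : Measure (GaugeConfig 4 L SU3)) (mq t : Fin Nf → ℝ) :
    0 ≤ realModeDensity μ mq t :=
  div_nonneg (integral_nonneg fun _ => Finset.sum_nonneg fun _ _ => Nat.cast_nonneg _)
    (by positivity)

/-- Under a probability measure the density is at most `12 N_f` real modes per site (each flavour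
has `12 L⁴` eigenvalues in all). [folklore] -/
theorem realModeDensity_le (μ : Measure (GaugeConfig 4 L SU3)) [IsProbabilityMeasure μ]
    (mq t : Fin Nf → ℝ) : realModeDensity μ mq t ≤ 12 * Nf := by
  have hL : (0 : ℝ) < (L : ℝ) ^ 4 := by
    have : (0 : ℝ) < L := by exact_mod_cast Nat.pos_of_ne_zero (NeZero.ne L)
    positivity
  have hbound : ∀ᵐ U ∂μ, ‖∑ f, (realEigenvalueCount U (mq f) (t f) : ℝ)‖ ≤ 12 * Nf * (L : ℝ) ^ 4 := by
    refine Eventually.of_forall fun U => ?_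
    rw [Real.norm_of_nonneg (Finset.sum_nonneg fun _ _ => Nat.cast_nonneg _)]
    calc ∑ f, (realEigenvalueCount U (mq f) (t f) : ℝ)
        ≤ ∑ _f : Fin Nf, (12 * (L : ℝ) ^ 4) :=
          Finset.sum_le_sum fun f _ => by exact_mod_cast realEigenvalueCount_le U (mq f) (t f)
      _ = 12 * Nf * (L : ℝ) ^ 4 := by
          rw [Finset.sum_const, Finset.card_univ, Fintype.card_fin, nsmul_eq_mul]; ring
  have h := norm_integral_le_of_norm_le_const hbound
  rw [probReal_univ, mul_one] at h
  unfold realModeDensity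
  rw [div_le_iff₀ hL]
  exact (Real.le_norm_self _).trans h

namespace QCDScheme

/-- **Quenched defect density of the scheme at step `k`** with flavour thresholds `t_f`: the expected
number per lattice site, under the pure-gauge Wilson measure `qcdGaugeMeasure sch k` on the scheme's
torus of side `2L_k + 1`, of real eigenvalues `≤ t_f` of `D_W(U, m_f(k), 1)`, summed over flavours
(the quenched ensembles of Edwards–Heller–Narayanan). [cite: EdwardsHellerNarayanan1999, §4 and §6] -/
def quenchedDefectDensity (sch : QCDScheme Nf) (t : Fin Nf → ℝ) (k : ℕ) : ℝ :=
  realModeDensity (qcdGaugeMeasure sch k) (fun f => sch.mq f k) t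

/-- **Reweighted (phase-quenched) defect density of the scheme at step `k`** with thresholds `t_f`:
the same expectation under the `|det|`-weighted lattice QCD measure
`Z⁻¹ e^{-β_k S_W(U)} ∏_f |det D_W(U, m_f(k), 1)| ∏ dU` (`qcdLatticeMeasure`, Mohler–Schaefer's `⟨·⟩₊`,
from which the signed theory is recovered by the factor `(-1)^{n_neg}`). [cite: MohlerSchaefer2020, §2.1] -/
def reweightedDefectDensity (sch : QCDScheme Nf) (t : Fin Nf → ℝ) (k : ℕ) : ℝ :=
  realModeDensity (qcdLatticeMeasure (sch.side k) (sch.β k) fun f => sch.mq f k)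
    (fun f => sch.mq f k) t

/-- The quenched density is non-negative. [folklore] -/
theorem quenchedDefectDensity_nonneg (sch : QCDScheme Nf) (t : Fin Nf → ℝ) (k : ℕ) :
    0 ≤ sch.quenchedDefectDensity t k :=
  realModeDensity_nonneg _ _ _

/-- The reweighted density is non-negative. [folklore] -/
theorem reweightedDefectDensity_nonneg (sch : QCDScheme Nf) (t : Fin Nf → ℝ) (k : ℕ) :
    0 ≤ sch.reweightedDefectDensity t k :=
  realModeDensity_nonneg _ _ _

/-- The quenched density is at most `12 N_f` per site (the Wilson measure of the fundamental `SU(3)`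
representation is a probability measure, `isProbabilityMeasure_wilsonMeasure`). [folklore] -/
theorem quenchedDefectDensity_le (sch : QCDScheme Nf) (t : Fin Nf → ℝ) (k : ℕ) :
    sch.quenchedDefectDensity t k ≤ 12 * Nf := by
  haveI : IsProbabilityMeasure (qcdGaugeMeasure sch k) :=
    isProbabilityMeasure_wilsonMeasure (fundamentalRep (Fin 3)) (continuous_fundamentalRep (n := Fin 3)) _
  exact realModeDensity_le _ _ _

end QCDScheme

namespace QCDRegularisation

/-- **The canonical defect threshold: half the clean gap.** On the bare trajectory
`m_f(k) = m_crit(k) + a_k m_f/Z_m(k)` a gauge field whose massless Wilson operator has no real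
eigenvalue below the critical edge `-m_crit(k)` gives `D_W(U, m_f(k), 1)` real eigenvalues
`≥ a_k m_f/Z_m(k)` only; a real eigenvalue `≤ a_k m_f/(2 Z_m(k))` is a SPECTRAL DEFECT of flavour `f`
(card af-entropy-vs-wilson-spectral-defects: "below the clean gap"). [folklore] -/
def defectThreshold (reg : QCDRegularisation Nf) (m : Fin Nf → ℝ) (k : ℕ) (f : Fin Nf) : ℝ :=
  reg.a k * m f / (2 * reg.Zm k)

/-- The defect threshold is positive for positive renormalised mass. [folklore] -/
theorem defectThreshold_pos (reg : QCDRegularisation Nf) {m : Fin Nf → ℝ} (k : ℕ) {f : Fin Nf}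
    (hm : 0 < m f) : 0 < reg.defectThreshold m k f :=
  div_pos (mul_pos (reg.a_pos k) hm) (mul_pos two_pos (reg.Zm_pos k))

/-- The threshold is half the clean gap `a_k m_f/Z_m(k) = m_f(k) - m_crit(k)`. [folklore] -/
theorem two_mul_defectThreshold (reg : QCDRegularisation Nf) (m : Fin Nf → ℝ) (k : ℕ) (f : Fin Nf)
    (z shift : QCDField Nf → ℕ → ℝ) :
    2 * reg.defectThreshold m k f = (reg.scheme m z shift).mq f k - reg.mcrit k := by
  rw [scheme_mq, defectThreshold]
  have hZ : reg.Zm k ≠ 0 := (reg.Zm_pos k).ne'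
  field_simp
  ring

end QCDRegularisation

/-- **`spectralDefectDensity reg m k` — the spectral-defect density of the regularisation `reg` at
renormalised masses `m` and step `k`**: the expected number PER LATTICE SITE, summed over flavours,
of real eigenvalues `≤ a_k m_f/(2 Z_m(k))` (half the clean gap) of `D_W(U, m_f(k), 1)` at the
trajectory's bare masses `m_f(k) = m_crit(k) + a_k m_f/Z_m(k)`, under the phase-quenched
(`|det|`-reweighted) lattice QCD measure at coupling `β_k` on the scheme's torus of side `2L_k + 1`
(`QCDScheme.reweightedDefectDensity` of `reg.scheme m 0 0`; the species renormalisations do not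
enter). The Wilson-specific input of the negative-bare-mass constructions is that this density PER
PHYSICAL VOLUME dies out along the scheme (`QCDRegularisation.HasSpectralDefectExtinction`).
[cite: MohlerSchaefer2020, §2.1 and §4.2] [cite: EdwardsHellerNarayanan1999, §6] -/
def spectralDefectDensity (reg : QCDRegularisation Nf) (m : Fin Nf → ℝ) (k : ℕ) : ℝ :=
  (reg.scheme m 0 0).reweightedDefectDensity (reg.defectThreshold m k) k

/-- **The quenched spectral-defect density** of `reg` at masses `m`, step `k`: as
`spectralDefectDensity` but under the pure-gauge Wilson measure `qcdGaugeMeasure` (the quenched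
ensembles in which Edwards–Heller–Narayanan measured the thinning of small real modes towards the
continuum limit). [cite: EdwardsHellerNarayanan1999, §4 and §6] -/
def quenchedSpectralDefectDensity (reg : QCDRegularisation Nf) (m : Fin Nf → ℝ) (k : ℕ) : ℝ :=
  (reg.scheme m 0 0).quenchedDefectDensity (reg.defectThreshold m k) k

/-- Unfolding `spectralDefectDensity` down to the integral. [folklore] -/
theorem spectralDefectDensity_eq (reg : QCDRegularisation Nf) (m : Fin Nf → ℝ) (k : ℕ) :
    spectralDefectDensity reg m k =
      (∫ U, (∑ f, (realEigenvalueCount U (reg.mcrit k + reg.a k * m f / reg.Zm k)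
          (reg.a k * m f / (2 * reg.Zm k)) : ℝ))
        ∂(qcdLatticeMeasure ((reg.scheme m 0 0).side k) (reg.β k)
          fun f => reg.mcrit k + reg.a k * m f / reg.Zm k)) /
        ((reg.scheme m 0 0).side k : ℝ) ^ 4 := rfl

/-- Unfolding `quenchedSpectralDefectDensity` down to the integral. [folklore] -/
theorem quenchedSpectralDefectDensity_eq (reg : QCDRegularisation Nf) (m : Fin Nf → ℝ) (k : ℕ) :
    quenchedSpectralDefectDensity reg m k =
      (∫ U, (∑ f, (realEigenvalueCount U (reg.mcrit k + reg.a k * m f / reg.Zm k)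
          (reg.a k * m f / (2 * reg.Zm k)) : ℝ)) ∂(qcdGaugeMeasure (reg.scheme m 0 0) k)) /
        ((reg.scheme m 0 0).side k : ℝ) ^ 4 := rfl

/-- The spectral-defect density is non-negative. [folklore] -/
theorem spectralDefectDensity_nonneg (reg : QCDRegularisation Nf) (m : Fin Nf → ℝ) (k : ℕ) :
    0 ≤ spectralDefectDensity reg m k :=
  realModeDensity_nonneg _ _ _

/-- The quenched spectral-defect density lies in `[0, 12 N_f]`. [folklore] -/
theorem quenchedSpectralDefectDensity_mem_Icc (reg : QCDRegularisation Nf) (m : Fin Nf → ℝ) (k : ℕ) :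
    quenchedSpectralDefectDensity reg m k ∈ Set.Icc (0 : ℝ) (12 * Nf) :=
  ⟨realModeDensity_nonneg _ _ _, QCDScheme.quenchedDefectDensity_le _ _ _⟩

/-- **Density per PHYSICAL four-volume** of a per-site density sequence `ρ` along `reg`:
`ρ k / a_k⁴` (a torus of side `S` has `S⁴` sites and physical volume `(S a_k)⁴`). BNN's "density of
dimension four" against which asymptotic freedom is to be weighed. [cite: BerrutoNarayananNeuberger2000, §7] -/
def QCDRegularisation.physicalDensity (reg : QCDRegularisation Nf) (ρ : ℕ → ℝ) (k : ℕ) : ℝ :=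
  ρ k / reg.a k ^ 4

/-- The spectral-defect density of `reg` at masses `m` PER PHYSICAL VOLUME (reweighted measure,
canonical threshold, scheme's torus). [cite: BerrutoNarayananNeuberger2000, §7] [cite: MohlerSchaefer2020, §4.2] -/
def physicalSpectralDefectDensity (reg : QCDRegularisation Nf) (m : Fin Nf → ℝ) (k : ℕ) : ℝ :=
  reg.physicalDensity (spectralDefectDensity reg m) k

/-- Unfolding the physical spectral-defect density. [folklore] -/
theorem physicalSpectralDefectDensity_eq (reg : QCDRegularisation Nf) (m : Fin Nf → ℝ) (k : ℕ) :
    physicalSpectralDefectDensity reg m k = spectralDefectDensity reg m k / reg.a k ^ 4 := rfl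

/-- The physical density of a non-negative sequence is non-negative. [folklore] -/
theorem QCDRegularisation.physicalDensity_nonneg (reg : QCDRegularisation Nf) {ρ : ℕ → ℝ} (k : ℕ)
    (h : 0 ≤ ρ k) : 0 ≤ reg.physicalDensity ρ k :=
  div_nonneg h (pow_nonneg (reg.a_pos k).le _)

/-- **Extinction of a defect density `ρ` along the regularisation**: the density per PHYSICAL
four-volume tends to `0`, `ρ k / a_k⁴ → 0` as `k → ∞` (card af-entropy-vs-wilson-spectral-defects,
Conjecture SD: spectral defects die out per physical volume along the asymptotically scaling
trajectory — the regime in which Mohler–Schaefer see `⟨n_neg⟩` fall from `2%` to `0.05%` between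
`β = 3.4` and `3.7` and Edwards–Heller–Narayanan see `ρ(0;m) → 0` away from the critical point).
Generic in `ρ` so that every rendering is one line: `reg.HasDefectExtinction (spectralDefectDensity reg m)`
(phase-quenched, canonical threshold, scheme's torus — `HasSpectralDefectExtinction`),
`reg.HasDefectExtinction (quenchedSpectralDefectDensity reg m)` (quenched), or densities built from
`realModeDensity` on larger tori / other thresholds. A predicate, not an assertion.
[cite: MohlerSchaefer2020, §4.2] [cite: EdwardsHellerNarayanan1999, §6] -/
def QCDRegularisation.HasDefectExtinction (reg : QCDRegularisation Nf) (ρ : ℕ → ℝ) : Prop :=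
  Tendsto (fun k => reg.physicalDensity ρ k) atTop (𝓝 0)

/-- **Spectral-defect extinction along the trajectory of renormalised masses `m`**: the
phase-quenched spectral-defect density per physical volume tends to `0` (the canonical instance of
`HasDefectExtinction`). [cite: MohlerSchaefer2020, §4.2] [cite: EdwardsHellerNarayanan1999, §6] -/
def QCDRegularisation.HasSpectralDefectExtinction (reg : QCDRegularisation Nf) (m : Fin Nf → ℝ) :
    Prop :=
  reg.HasDefectExtinction (spectralDefectDensity reg m)

/-- `HasSpectralDefectExtinction` unfolded: `physicalSpectralDefectDensity reg m k → 0`. [folklore] -/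
theorem QCDRegularisation.hasSpectralDefectExtinction_iff (reg : QCDRegularisation Nf)
    (m : Fin Nf → ℝ) :
    reg.HasSpectralDefectExtinction m ↔
      Tendsto (fun k => physicalSpectralDefectDensity reg m k) atTop (𝓝 0) := Iff.rfl

/-- The identically vanishing density is extinct (non-vacuity of the predicate; e.g. a spectrally
clean trajectory). [folklore] -/
theorem QCDRegularisation.hasDefectExtinction_zero (reg : QCDRegularisation Nf) :
    reg.HasDefectExtinction (fun _ => 0) := by
  simp [QCDRegularisation.HasDefectExtinction, QCDRegularisation.physicalDensity]

/-- **Extinction is monotone**: a non-negative density dominated by an extinct one is extinct (how a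
bound on all tori / a larger threshold transfers down). [folklore] -/
theorem QCDRegularisation.HasDefectExtinction.of_le (reg : QCDRegularisation Nf) {ρ σ : ℕ → ℝ}
    (hσ : reg.HasDefectExtinction σ) (h0 : ∀ k, 0 ≤ ρ k) (hle : ∀ k, ρ k ≤ σ k) :
    reg.HasDefectExtinction ρ := by
  refine squeeze_zero (fun k => reg.physicalDensity_nonneg k (h0 k)) (fun k => ?_) hσ
  exact div_le_div_of_nonneg_right (hle k) (pow_nonneg (reg.a_pos k).le _)

/-! ### Localisation of a real mode in a box -/

/-- The sites of the torus of side `L` in the box of radius `R` about (the image of) `c ∈ ℤ⁴`: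
the image of `c + {-R, …, R}⁴` under `Torus.proj` (all of the torus once `2R + 1 ≥ L`). [folklore] -/
def torusBox (L : ℕ) (c : _root_.Literature.Probability.LatticeModels.Site 4) (R : ℕ) : Finset (TorusSite 4 L) :=
  (box 4 R).image fun y => Torus.proj L (c + y)

/-- The centre belongs to its box. [folklore] -/
theorem proj_mem_torusBox (L : ℕ) (c : _root_.Literature.Probability.LatticeModels.Site 4) (R : ℕ) : Torus.proj L c ∈ torusBox L c R :=
  Finset.mem_image.mpr ⟨0, zero_mem_box 4 R, by rw [add_zero]⟩

/-- Boxes grow with the radius. [folklore] -/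
theorem torusBox_mono (L : ℕ) (c : _root_.Literature.Probability.LatticeModels.Site 4) : Monotone (torusBox L c) := fun _ _ h =>
  Finset.image_subset_image (box_mono 4 h)

/-- **The ℓ²-mass of a one-flavour quark-index vector `v` on the set of sites `B`**:
`∑_{x ∈ B, a, α} |v(x, a, α)|²`. [folklore] -/
def boxMass (v : QuarkIdx L → ℂ) (B : Finset (TorusSite 4 L)) : ℝ :=
  ∑ i ∈ Finset.univ.filter (fun i : QuarkIdx L => i.1 ∈ B), ‖v i‖ ^ 2

/-- The mass on a set of sites is non-negative. [folklore] -/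
theorem boxMass_nonneg (v : QuarkIdx L → ℂ) (B : Finset (TorusSite 4 L)) : 0 ≤ boxMass v B :=
  Finset.sum_nonneg fun _ _ => by positivity

/-- The mass on a set of sites is at most the total mass `∑_i |v i|²`. [folklore] -/
theorem boxMass_le (v : QuarkIdx L → ℂ) (B : Finset (TorusSite 4 L)) :
    boxMass v B ≤ ∑ i, ‖v i‖ ^ 2 :=
  Finset.sum_le_sum_of_subset_of_nonneg (Finset.filter_subset _ _) fun _ _ _ => by positivity

/-- On all sites the mass is the total mass. [folklore] -/
theorem boxMass_univ (v : QuarkIdx L → ℂ) : boxMass v Finset.univ = ∑ i, ‖v i‖ ^ 2 := by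
  simp [boxMass]

/-- **`(1 - ε)`-localisation of a vector in a set of sites**: at least the fraction `1 - ε` of the
ℓ²-mass of `v` sits on `B` ("singular-vector mass `≥ 1 - ε` inside the box" for a unit vector).
Golterman–Shamir's exponentially localised modes (their (4.1): `|Ψ(x)|² ≤ (c₁/l⁴) e^{-|x - x₀|/l}`)
are `(1-ε)`-localised in boxes of radius `O(l log(1/ε))` about `x₀`; on a finite torus every vector
is trivially localised in the whole torus, so the content is in `R` (and `ε`) being fixed while
`L` grows. [cite: GoltermanShamir2003, §4.1 (4.1)] -/
def IsBoxLocalised (v : QuarkIdx L → ℂ) (B : Finset (TorusSite 4 L)) (ε : ℝ) : Prop :=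
  (1 - ε) * ∑ i, ‖v i‖ ^ 2 ≤ boxMass v B

/-- Localisation is monotone in the set of sites. [folklore] -/
theorem IsBoxLocalised.mono {v : QuarkIdx L → ℂ} {B B' : Finset (TorusSite 4 L)} {ε : ℝ}
    (h : IsBoxLocalised v B ε) (hB : B ⊆ B') : IsBoxLocalised v B' ε := by
  refine le_trans h (Finset.sum_le_sum_of_subset_of_nonneg ?_ fun _ _ _ => by positivity)
  exact Finset.monotone_filter_right _ fun i _ (hi : i.1 ∈ B) => hB hi

/-- Localisation is monotone in the tolerance `ε`. [folklore] -/
theorem IsBoxLocalised.of_le {v : QuarkIdx L → ℂ} {B : Finset (TorusSite 4 L)} {ε ε' : ℝ}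
    (h : IsBoxLocalised v B ε) (hε : ε ≤ ε') : IsBoxLocalised v B ε' :=
  le_trans (mul_le_mul_of_nonneg_right (by linarith) (Finset.sum_nonneg fun _ _ => by positivity)) h

/-- Every vector is `1`-localised anywhere and `0`-localised on the whole torus (the trivial
finite-volume localisation Golterman–Shamir warn about). [cite: GoltermanShamir2003, §4 (opening paragraph)] -/
theorem isBoxLocalised_univ_zero (v : QuarkIdx L → ℂ) : IsBoxLocalised v Finset.univ 0 := by
  rw [IsBoxLocalised, boxMass_univ]; simp

/-- **A real mode of `D_W(U, m₀, 1)` at the real eigenvalue `ev`, `(1-ε)`-localised in the box of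
radius `R` about `c`**: there is a non-zero vector `v` with `D_W(U, m₀, 1) v = ev · v` (so `ev` is a
real eigenvalue and `v` a right singular vector of `D_W - ev` for the singular value `0`) carrying at
least the fraction `1 - ε` of its ℓ²-mass on the sites of `torusBox L c R` — the "small localized
modes" of size "about 1 or 2 lattice spacings" of Edwards–Heller–Narayanan and the cluster-supported
exact real modes of Berruto–Narayanan–Neuberger, made quantitative by `(R, ε)`. [cite: EdwardsHellerNarayanan1999, §4 (size of the crossing modes)] [cite: BerrutoNarayananNeuberger2000, §2] [cite: GoltermanShamir2003, §4.1] -/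
def HasLocalisedRealMode (U : GaugeConfig 4 L SU3) (m₀ ev : ℝ) (c : _root_.Literature.Probability.LatticeModels.Site 4) (R : ℕ) (ε : ℝ) :
    Prop :=
  ∃ v : QuarkIdx L → ℂ, v ≠ 0 ∧
    (wilsonDirac (fundamentalRep (Fin 3)) U m₀ 1).mulVec v = (ev : ℂ) • v ∧
      IsBoxLocalised v (torusBox L c R) ε

/-- A localised real mode stays localised in every larger box and for every larger tolerance. [folklore] -/
theorem HasLocalisedRealMode.mono {U : GaugeConfig 4 L SU3} {m₀ ev : ℝ} {c : _root_.Literature.Probability.LatticeModels.Site 4} {R R' : ℕ}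
    {ε ε' : ℝ} (h : HasLocalisedRealMode U m₀ ev c R ε) (hR : R ≤ R') (hε : ε ≤ ε') :
    HasLocalisedRealMode U m₀ ev c R' ε' := by
  obtain ⟨v, hv, hDv, hloc⟩ := h
  exact ⟨v, hv, hDv, (hloc.mono (torusBox_mono L c hR)).of_le hε⟩

/-- **A localised real mode is a real mode**: its eigenvalue is a root of the characteristic
polynomial, so it is counted by `realEigenvalueCount` at every threshold `t ≥ ev`. [folklore] -/
theorem HasLocalisedRealMode.one_le_realEigenvalueCount {U : GaugeConfig 4 L SU3} {m₀ ev : ℝ}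
    {c : _root_.Literature.Probability.LatticeModels.Site 4} {R : ℕ} {ε : ℝ} (h : HasLocalisedRealMode U m₀ ev c R ε) {t : ℝ} (ht : ev ≤ t) :
    1 ≤ realEigenvalueCount U m₀ t := by
  obtain ⟨v, hv, hDv, -⟩ := h
  set D := wilsonDirac (fundamentalRep (Fin 3)) U m₀ 1 with hD
  have heig : Module.End.HasEigenvalue (Matrix.toLin' D) (ev : ℂ) :=
    Module.End.hasEigenvalue_of_hasEigenvector
      ⟨by rw [Module.End.mem_eigenspace_iff, Matrix.toLin'_apply, hDv], hv⟩
  have hroot : (ev : ℂ) ∈ D.charpoly.roots := by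
    rw [Polynomial.mem_roots (Matrix.charpoly_monic D).ne_zero, ← Matrix.charpoly_toLin']
    exact (Module.End.hasEigenvalue_iff_isRoot_charpoly _ _).mp heig
  refine (realEigenvalueCount_mono U m₀ ht) |>.trans' ?_
  change 0 < realSpecCount D ev
  exact Multiset.countP_pos.mpr ⟨(ev : ℂ), hroot, Complex.ofReal_im ev, by simp⟩

end Wilson

end Literature.MathematicalPhysics.QuantumFieldTheory

end
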